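import Summits.NavierStokesRegularity.NavierStokesRegularity.Theorems.TerminalTraceTypeITraceScarL3SqrtTwoApexCloser
import Summits.NavierStokesRegularity.NavierStokesRegularity.Theorems.TerminalTraceTypeITraceScarL3SqrtTwoApexPressureGauge
import HarnessLib

/-!
# ROUND-27 target (b) `target_shell_pressure_L1` for the PACKAGE pressure (item `TerminalTrace.TypeITraceScarL3`,
# stmt-NavierStokesRegularity-18385, Stub LOUD line; helper)

Seat nsreg-C26-p1 g2 (cell ns-regularity-ideate), `--supports stmt-NavierStokesRegularity-18385` (helper);
planner-of-record nsreg-p2 g29 (R27 v2 l.213 `target_shell_pressure_L1`); pressure tools by nsreg-typer g21 (plate b2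
`exists_shellBudget_of_mild`) and nsreg-p7 (`sliceFunctional_eq_zero_of_mild`).

* `shellPressureBudget_of_apexPackage` — `target_shell_pressure_L1` with `ApexPackage`/`QuietShell` spelled out
  (= the hypothesis `hSP` of `rateSqThreshold_of_shellPressureBudget`, now DISCHARGED): for an extinct Type-I apex
  package that is quiet on `]−δ,0[ × {R < |y| < AR}` there are `m_P`, `δ' > 0` and a gauge `c : ℝ → ℝ` with
  `∫_{(2R+AR)/3 < |y| < (R+2AR)/3} ‖P(s) − c(s)‖ ≤ m_P` for a.e. `s ∈ ]−δ', 0[`.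
  Proof: on each window `]−δ'−1, −1/(n+1)[` the classical pressure `qₙ` of the representative has the budget at EVERY
  time (b2 with inputs from `…ReprSliceBounds`), and `P(s) − qₙ(s)` is a.e. constant for a.e. `s`
  (`ae_exists_gauge_window_pressure`); the windows exhaust `]−δ', 0[`.

WHAT THIS IS NOT: not T27-A (already landed: `two_le_rateSq_of_quietShell`), not NS regularity — bookkeeping that
closes ROUND-27's typed target list (a)–(e).  [folklore]
-/

noncomputable section

set_option linter.dupNamespace false

namespace Summit.NavierStokesRegularity.NavierStokesRegularity.Theorems.TypeITraceScarL3

open MeasureTheory Set Function Filter Topology Metric InnerProductSpace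
open Literature.Analysis Literature.Analysis.FluidPDE Literature.Analysis.UnboundedOperators
open scoped NNReal ENNReal RealInnerProductSpace ContDiff

/-- **ROUND-27 (b) `target_shell_pressure_L1`, spelled out** (module docstring). [folklore] -/
theorem shellPressureBudget_of_apexPackage :
    ∀ (M D₀ : ℝ≥0) (C : ℝ)
      (U : ℝ → EuclideanSpace ℝ (Fin 3) → EuclideanSpace ℝ (Fin 3))
      (P : ℝ → EuclideanSpace ℝ (Fin 3) → ℝ)
      (G : ℝ → EuclideanSpace ℝ (Fin 3) →
        EuclideanSpace ℝ (Fin 3) →L[ℝ] EuclideanSpace ℝ (Fin 3)),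
      (∀ a : ℝ, 0 < a →
        IsSuitableWeakSolutionInBall a (0 : ℝ × EuclideanSpace ℝ (Fin 3)) U P) →
      (∀ a : ℝ, 0 < a →
        HasWeakSpatialGradientOn
          (parabolicCylinderOpens a (0 : ℝ × EuclideanSpace ℝ (Fin 3))) U G) →
      (∀ a : ℝ, 0 < a →
        typeIBound (parabolicCylinder a (0 : ℝ × EuclideanSpace ℝ (Fin 3))) U P G ≤ M) →
      (∀ z₀ : ℝ × EuclideanSpace ℝ (Fin 3), z₀.1 ≤ 0 →
        ∀ r : ℝ, 0 < r → cknD r z₀ P ≤ D₀) →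
      (∀ s : ℝ, s < 0 →
        ∀ᵐ y : EuclideanSpace ℝ (Fin 3), ‖U s y‖ ≤ C / Real.sqrt (-s)) →
      (∀ φ : EuclideanSpace ℝ (Fin 3) → EuclideanSpace ℝ (Fin 3),
        ContDiff ℝ (⊤ : ℕ∞) φ →
        HasCompactSupport φ → ∀ ε : ℝ, 0 < ε →
        ∃ s₀ : ℝ, s₀ < 0 ∧ ∀ᵐ s ∂(volume.restrict (Ioo s₀ 0)), |∫ y, ⟪U s y, φ y⟫| ≤ ε) →
      ∀ (A R δ K : ℝ), 1 < A → 0 < R → 0 < δ →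
        (∀ᵐ z ∂(volume.restrict
          (Ioo (-δ) 0 ×ˢ {y : EuclideanSpace ℝ (Fin 3) | R < ‖y‖ ∧ ‖y‖ < A * R})),
            ‖U z.1 z.2‖ ≤ K) →
        ∃ (mP δ' : ℝ), 0 < δ' ∧ ∃ c : ℝ → ℝ,
          ∀ᵐ s ∂(volume.restrict (Ioo (-δ') 0)),
            ∫⁻ y in {y : EuclideanSpace ℝ (Fin 3) |
                (2 * R + A * R) / 3 < ‖y‖ ∧ ‖y‖ < (R + 2 * A * R) / 3}, ‖P s y - c s‖ₑ ≤
              ENNReal.ofReal mP := by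
  intro M D₀ C U P G hsw hG hI hD hrate htop A R δ K hA hR hδ hq
  classical
  -- ### the representative and the constants (as in `two_le_rateSq_of_quietShell`)
  obtain ⟨V, hUV, hVc, hdec, hsm, -, hmild, hwin, -⟩ := exists_classical_repr_of_apexPackage hsw hI hrate
  have hUVs := ae_slice_eq_of_ae_eq_slab hUV
  have hC0 : 0 ≤ C := by
    have h := hdec (-1) (by norm_num) 0
    rw [neg_neg, Real.sqrt_one, div_one] at h
    exact (norm_nonneg _).trans h
  have hAR : R < A * R := by nlinarith
  have hr : 0 < A * R := by positivity
  have h2r : 0 < 2 * (A * R) := by positivity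
  obtain ⟨Cb, Fb, hCb, hFb, hbud⟩ := exists_shellBudget_of_mild hr
  have hvolT : volume {z : EuclideanSpace ℝ (Fin 3) | R < ‖z‖ ∧ ‖z‖ < A * R} ≠ ⊤ := by
    refine ne_top_of_le_ne_top (measure_ball_lt_top (μ := volume) (x := (0 : EuclideanSpace ℝ (Fin 3)))
      (r := A * R)).ne (measure_mono fun z hz => ?_)
    rw [mem_ball_zero_iff]; exact hz.2
  obtain ⟨B₀, hB₀def⟩ : ∃ B₀ : ℝ≥0∞, B₀ =
      Cb * ENNReal.ofReal K ^ 2 * volume {z : EuclideanSpace ℝ (Fin 3) | R < ‖z‖ ∧ ‖z‖ < A * R} +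
        (ENNReal.ofReal ((2 * Real.pi * ((A * R - R) / 3) ^ 3)⁻¹) * ENNReal.ofReal (2 * (2 * (A * R)) * M) +
            Fb * ENNReal.ofReal (2 * (A * R) * M)) *
          volume {z : EuclideanSpace ℝ (Fin 3) | R < ‖z‖ ∧ ‖z‖ < A * R} := ⟨_, rfl⟩
  have hB₀ : B₀ ≠ ⊤ := by
    rw [hB₀def]
    refine ENNReal.add_ne_top.2 ⟨ENNReal.mul_ne_top (ENNReal.mul_ne_top hCb (ENNReal.pow_ne_top ENNReal.ofReal_ne_top)) hvolT,
      ENNReal.mul_ne_top (ENNReal.add_ne_top.2 ⟨ENNReal.mul_ne_top ENNReal.ofReal_ne_top ENNReal.ofReal_ne_top,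
        ENNReal.mul_ne_top hFb ENNReal.ofReal_ne_top⟩) hvolT⟩
  obtain ⟨δ', hδ'def⟩ : ∃ δ' : ℝ, δ' = min δ ((A * R) ^ 2) := ⟨_, rfl⟩
  have hδ' : 0 < δ' := by rw [hδ'def]; exact lt_min hδ (by positivity)
  -- ### budget of ANY window pressure of `V` at EVERY time `t ∈ ]−δ', 0[`, on the open middle third
  have hwinB : ∀ t ∈ Ioo (-δ') 0, ∀ (a b : ℝ) (q : ℝ → EuclideanSpace ℝ (Fin 3) → ℝ), t ∈ Ioo a b →
      IsClassicalNSSolutionOn (Ioo a b) 1 0 V q →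
      ∃ κ : ℝ, ∫⁻ y in {y : EuclideanSpace ℝ (Fin 3) | (2 * R + A * R) / 3 < ‖y‖ ∧ ‖y‖ < (R + 2 * A * R) / 3},
        ‖q t y - κ‖ₑ ≤ B₀ := by
    intro t ht a b q htab hcl
    have htδ : -δ < t := by
      have : δ' ≤ δ := by rw [hδ'def]; exact min_le_left _ _
      linarith [ht.1]
    have htr : -(A * R) ^ 2 < t := by
      have : δ' ≤ (A * R) ^ 2 := by rw [hδ'def]; exact min_le_right _ _
      linarith [ht.1]
    have ht0 : t < 0 := ht.2
    obtain ⟨η, hηdef⟩ : ∃ η : ℝ, η = min (min (t - a) (b - t)) (-t) / 2 := ⟨_, rfl⟩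
    have hη : 0 < η := by
      rw [hηdef]; exact half_pos (lt_min (lt_min (by linarith [htab.1]) (by linarith [htab.2])) (by linarith))
    have hη1 : η ≤ (t - a) / 2 := by
      rw [hηdef]; linarith [min_le_left (min (t - a) (b - t)) (-t), min_le_left (t - a) (b - t)]
    have hη2 : η ≤ (b - t) / 2 := by
      rw [hηdef]; linarith [min_le_left (min (t - a) (b - t)) (-t), min_le_right (t - a) (b - t)]
    have hη3 : η ≤ -t / 2 := by rw [hηdef]; linarith [min_le_right (min (t - a) (b - t)) (-t)]
    have hIcc : Icc (t - η) (t + η) ⊆ Ioo a b := fun s hs => ⟨by linarith [hs.1], by linarith [hs.2]⟩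
    have hsq : 0 < Real.sqrt (-(t + η)) := Real.sqrt_pos.2 (by linarith)
    have hM'0 : 0 ≤ C / Real.sqrt (-(t + η)) := div_nonneg hC0 hsq.le
    have hM' : ∀ σ ∈ Icc (t - η) (t + η), ∀ y, ‖V σ y‖ ≤ C / Real.sqrt (-(t + η)) := by
      intro σ hσ y
      have hσ0 : σ < 0 := by linarith [hσ.2]
      refine (hdec σ hσ0 y).trans (div_le_div_of_nonneg_left hC0 hsq ?_)
      exact Real.sqrt_le_sqrt (by linarith [hσ.2])
    have hmild' : ∀ s t' : ℝ, s ∈ Icc (t - η) (t + η) → t' ∈ Icc (t - η) (t + η) → s < t' → ∀ x,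
        V t' x = heatExtension (V s) (t' - s) x - oseenDuhamel 1 s V V t' x :=
      fun s t' _ ht' hst' x => hmild s t' hst' (by linarith [ht'.2]) x
    have hα : ∀ z : EuclideanSpace ℝ (Fin 3), ∫⁻ y in ball z (A * R), ‖V t y‖ₑ ^ 2 ≤
        ENNReal.ofReal (2 * (A * R) * M) := fun z => lintegral_ball_repr_sq_le hI hUVs hsm hr z ⟨htr, ht0⟩
    have hKb : ∀ y : EuclideanSpace ℝ (Fin 3), R < ‖y‖ → ‖y‖ < A * R → ‖V t y‖ ≤ K :=
      norm_repr_le_of_quietShell hq hUV hVc t ⟨htδ, ht0⟩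
    obtain ⟨κ, hκ⟩ := hbud isOpen_Ioo hcl hη hIcc hM'0 hM' hmild' hα (by linarith) hKb
    have hle := hκ ((A * R - R) / 3) ((2 * R + A * R) / 3) ((R + 2 * A * R) / 3) (by linarith)
      (by linarith) (by linarith) (by linarith)
    have h2ball : ∫⁻ z in ball (0 : EuclideanSpace ℝ (Fin 3)) (2 * (A * R)), ‖V t z‖ₑ ^ 2 ≤
        ENNReal.ofReal (2 * (2 * (A * R)) * M) :=
      lintegral_ball_repr_sq_le hI hUVs hsm h2r 0 ⟨by nlinarith, ht0⟩
    refine ⟨κ, hle.trans ?_⟩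
    rw [hB₀def]
    gcongr
  -- ### the windows `]−δ'−1, −1/(n+1)[` and the gauge on each
  have hstep : ∀ n : ℕ, ∀ᵐ s ∂(volume.restrict (Ioo (-δ') 0)), s < -(1 / ((n : ℝ) + 1)) →
      ∃ c₀ : ℝ, ∫⁻ y in {y : EuclideanSpace ℝ (Fin 3) | (2 * R + A * R) / 3 < ‖y‖ ∧ ‖y‖ < (R + 2 * A * R) / 3},
        ‖P s y - c₀‖ₑ ≤ B₀ := by
    intro n
    have hn : (0 : ℝ) < 1 / ((n : ℝ) + 1) := by positivity
    have hn1 : 1 / ((n : ℝ) + 1) ≤ 1 := by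
      rw [div_le_one (by positivity)]; linarith [(Nat.cast_nonneg n : (0 : ℝ) ≤ n)]
    obtain ⟨q, hcl⟩ := hwin (-δ' - 1) (-(1 / ((n : ℝ) + 1))) (by linarith) (by linarith)
    have hg := ae_exists_gauge_window_pressure hsw hUV (by linarith : -(1 / ((n : ℝ) + 1)) ≤ 0) hcl
    -- move to the measure restricted to `]−δ', 0[`
    have hg' : ∀ᵐ s ∂(volume : Measure ℝ), s ∈ Ioo (-δ' - 1) (-(1 / ((n : ℝ) + 1))) →
        ∃ κ : ℝ, ∀ᵐ x : EuclideanSpace ℝ (Fin 3), P s x - q s x = κ :=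
      (ae_restrict_iff' measurableSet_Ioo).1 hg
    filter_upwards [ae_restrict_of_ae (s := Ioo (-δ') 0) hg', ae_restrict_mem measurableSet_Ioo] with s hs hsI hsn
    have hsW : s ∈ Ioo (-δ' - 1) (-(1 / ((n : ℝ) + 1))) := ⟨by linarith [hsI.1], hsn⟩
    obtain ⟨κ, hκ⟩ := hs hsW
    obtain ⟨κ', hκ'⟩ := hwinB s hsI _ _ q hsW hcl
    refine ⟨κ + κ', le_of_eq_of_le (lintegral_congr_ae ?_) hκ'⟩
    filter_upwards [ae_restrict_of_ae (s := {y : EuclideanSpace ℝ (Fin 3) |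
      (2 * R + A * R) / 3 < ‖y‖ ∧ ‖y‖ < (R + 2 * A * R) / 3}) hκ] with y hy
    rw [show P s y - (κ + κ') = q s y - κ' by linarith]
  have hall : ∀ᵐ s ∂(volume.restrict (Ioo (-δ') 0)),
      ∃ c₀ : ℝ, ∫⁻ y in {y : EuclideanSpace ℝ (Fin 3) | (2 * R + A * R) / 3 < ‖y‖ ∧ ‖y‖ < (R + 2 * A * R) / 3},
        ‖P s y - c₀‖ₑ ≤ B₀ := by
    filter_upwards [ae_all_iff.2 hstep, ae_restrict_mem measurableSet_Ioo] with s hs hsI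
    obtain ⟨n, hn⟩ := exists_nat_one_div_lt (by linarith [hsI.2] : 0 < -s)
    exact hs n (by linarith)
  -- ### the gauge
  refine ⟨B₀.toReal, δ', hδ', fun s => if h : ∃ c₀ : ℝ,
      ∫⁻ y in {y : EuclideanSpace ℝ (Fin 3) | (2 * R + A * R) / 3 < ‖y‖ ∧ ‖y‖ < (R + 2 * A * R) / 3},
        ‖P s y - c₀‖ₑ ≤ B₀ then h.choose else 0, ?_⟩
  filter_upwards [hall] with s hs
  rw [dif_pos hs, ENNReal.ofReal_toReal hB₀]
  exact hs.choose_spec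

end Summit.NavierStokesRegularity.NavierStokesRegularity.Theorems.TypeITraceScarL3

end
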